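import Literature.MathematicalPhysics.QuantumLattice.FermionOperatorsProofs
import Literature.MathematicalPhysics.QuantumLattice.HubbardLiebConfig
import Literature.MathematicalPhysics.QuantumLattice.SectorEigenvalueContinuation
import HarnessLib

/-!
# Route `LiebTwin`, crux `TwinOnsiteCondensation` (stmt-HubbardSuperconductivity-15258), line `majorant`:
# the creation-side cap of the spin-flip majorant (helper, `--supports`)

Frobenius bookkeeping for the co-twin factor of the spin-flip majorant M2 (`stub_spinFlipMajorant`). For a
finite family of rectangular contractions `U_x : ℂ^ι → ℂ^a` (`‖U_x v‖ ≤ ‖v‖`, `x ∈ Λ`) and any square `B`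
on `ι`:

  `Σ_{i,i'} ‖(Σ_x U_x B U_xᴴ)_{ii'}‖² ≤ |Λ|² · Σ_{k,k'} ‖B_{kk'}‖²`   (`sum_norm_sq_sum_conj_le`)

(Jensen over `x`, then `‖U M‖_F ≤ ‖M‖_F` and `‖M Uᴴ‖_F ≤ ‖M‖_F` for a contraction `U`). The creation operator
`c†_x` with its column index restricted to `n`-subsets, `(creation x).submatrix id val`, is such a contraction
(`(c†_x)ᴴ c†_x = 1 - n_x`; `re_star_creation_submatrix_mulVec_le`), which gives the creation-side CAP
`sum_norm_sq_sum_creation_conj_le` (the registered sub-goal of this file). Also recorded for the assembly of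
M2: the block kernel `1 ⊗ G` of a contraction `G` is a contraction (`re_star_blockKernel_mulVec_le`).
Pure finite-dimensional linear algebra (Horn–Johnson, *Matrix Analysis* (2012) §5.6) and the CAR
(Bratteli–Robinson II §5.2.2). No definition and no named fact is introduced.
-/

-- the mandated namespace `Summit.<Summit>.<Problem>.Theorems` repeats `HubbardSuperconductivity`
-- (single-problem summit, D-0017), which the `dupNamespace` linter flags on every declaration
set_option linter.dupNamespace false

noncomputable section

namespace Summit.HubbardSuperconductivity.HubbardSuperconductivity.Theorems.LiebTwinMajorant.SpinFlip

open Matrix Finset Literature.MathematicalPhysics.QuantumLattice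
open scoped ComplexOrder

/-! ### Frobenius bookkeeping for rectangular contractions -/

section Frobenius

variable {a b J : Type*} [Fintype a] [Fintype b] [Fintype J]

/-- **A contraction does not increase the Frobenius norm (left multiplication)**: if `‖K v‖ ≤ ‖v‖` for
all `v` (rectangular `K`), then `Σ_{i,j} ‖(K M)_{ij}‖² ≤ Σ_{i',j} ‖M_{i'j}‖²` (columnwise).
Horn–Johnson, Matrix Analysis (2012) §5.6. [folklore] -/
theorem sum_norm_sq_mul_le (K : Matrix a J ℂ)
    (hK : ∀ v : J → ℂ, (star (K *ᵥ v) ⬝ᵥ (K *ᵥ v)).re ≤ (star v ⬝ᵥ v).re) (M : Matrix J b ℂ) :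
    ∑ i : a, ∑ j : b, ‖(K * M) i j‖ ^ 2 ≤ ∑ i' : J, ∑ j : b, ‖M i' j‖ ^ 2 := by
  rw [Finset.sum_comm, Finset.sum_comm (f := fun (i' : J) (j : b) => ‖M i' j‖ ^ 2)]
  refine Finset.sum_le_sum fun j _ => ?_
  have h := hK fun i' => M i' j
  rw [EigenvalueContinuation.re_star_dotProduct_self, EigenvalueContinuation.re_star_dotProduct_self] at h
  simpa only [mul_apply', mulVec] using h

/-- **A contraction does not increase the Frobenius norm (right multiplication by the adjoint)**:
`Σ_{i,j} ‖(M Kᴴ)_{ij}‖² ≤ Σ_{i,j'} ‖M_{ij'}‖²` for a rectangular contraction `K`.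
Horn–Johnson, Matrix Analysis (2012) §5.6. [folklore] -/
theorem sum_norm_sq_mul_conjTranspose_le (K : Matrix a J ℂ)
    (hK : ∀ v : J → ℂ, (star (K *ᵥ v) ⬝ᵥ (K *ᵥ v)).re ≤ (star v ⬝ᵥ v).re) (M : Matrix b J ℂ) :
    ∑ i : b, ∑ j : a, ‖(M * Kᴴ) i j‖ ^ 2 ≤ ∑ i : b, ∑ j' : J, ‖M i j'‖ ^ 2 := by
  have e : M * Kᴴ = (K * Mᴴ)ᴴ := by rw [conjTranspose_mul, conjTranspose_conjTranspose]
  have h := sum_norm_sq_mul_le K hK Mᴴ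
  rw [e, Finset.sum_comm]
  simp only [conjTranspose_apply, norm_star]
  refine h.trans_eq ?_
  rw [Finset.sum_comm]
  simp only [conjTranspose_apply, norm_star]

/-- **Frobenius cap for a sum of contracted copies.** For rectangular contractions `U_x : ℂ^ι → ℂ^a`
(`x ∈ Λ`) and a square `B` on `ι`: `Σ_{i,i'} ‖(Σ_x U_x B U_xᴴ)_{ii'}‖² ≤ |Λ|² Σ_{k,k'} ‖B_{kk'}‖²` (Jensen
`‖Σ_x m_x‖² ≤ |Λ| Σ_x ‖m_x‖²` entrywise, then the two one-sided contraction bounds).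
Horn–Johnson, Matrix Analysis (2012) §5.6. [folklore] -/
theorem sum_norm_sq_sum_conj_le {Λ' ι : Type*} [Fintype Λ'] [Fintype ι] (U : Λ' → Matrix a ι ℂ)
    (hU : ∀ (x : Λ') (v : ι → ℂ), (star (U x *ᵥ v) ⬝ᵥ (U x *ᵥ v)).re ≤ (star v ⬝ᵥ v).re)
    (B : Matrix ι ι ℂ) :
    ∑ i : a, ∑ i' : a, ‖(∑ x, U x * B * (U x)ᴴ) i i'‖ ^ 2 ≤
      (Fintype.card Λ' : ℝ) ^ 2 * ∑ k : ι, ∑ k' : ι, ‖B k k'‖ ^ 2 := by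
  -- Jensen / Cauchy–Schwarz for a finite family of complex numbers
  have jensen : ∀ m : Λ' → ℂ, ‖∑ x, m x‖ ^ 2 ≤ Fintype.card Λ' * ∑ x, ‖m x‖ ^ 2 := fun m =>
    calc ‖∑ x, m x‖ ^ 2 ≤ (∑ x, ‖m x‖) ^ 2 := by
          gcongr
          exact norm_sum_le _ _
      _ ≤ (Finset.univ.card : ℝ) * ∑ x, ‖m x‖ ^ 2 := sq_sum_le_card_mul_sum_sq
      _ = Fintype.card Λ' * ∑ x, ‖m x‖ ^ 2 := by rw [Finset.card_univ]
  calc ∑ i : a, ∑ i' : a, ‖(∑ x, U x * B * (U x)ᴴ) i i'‖ ^ 2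
      ≤ ∑ i : a, ∑ i' : a, ((Fintype.card Λ' : ℝ) * ∑ x, ‖(U x * B * (U x)ᴴ) i i'‖ ^ 2) := by
        refine Finset.sum_le_sum fun i _ => Finset.sum_le_sum fun i' _ => ?_
        rw [Matrix.sum_apply]
        exact jensen _
    _ = (Fintype.card Λ' : ℝ) * ∑ x, ∑ i : a, ∑ i' : a, ‖(U x * B * (U x)ᴴ) i i'‖ ^ 2 := by
        simp only [Finset.mul_sum]
        exact (Finset.sum_congr rfl fun i _ => Finset.sum_comm).trans Finset.sum_comm
    _ ≤ (Fintype.card Λ' : ℝ) * ∑ _x : Λ', ∑ k : ι, ∑ k' : ι, ‖B k k'‖ ^ 2 := by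
        gcongr with x
        calc ∑ i : a, ∑ i' : a, ‖(U x * B * (U x)ᴴ) i i'‖ ^ 2
            ≤ ∑ k : ι, ∑ i' : a, ‖(B * (U x)ᴴ) k i'‖ ^ 2 := by
              rw [Matrix.mul_assoc]
              exact sum_norm_sq_mul_le (U x) (hU x) _
          _ ≤ ∑ k : ι, ∑ k' : ι, ‖B k k'‖ ^ 2 := sum_norm_sq_mul_conjTranspose_le (U x) (hU x) B
    _ = (Fintype.card Λ' : ℝ) ^ 2 * ∑ k : ι, ∑ k' : ι, ‖B k k'‖ ^ 2 := by
        rw [Finset.sum_const, Finset.card_univ, nsmul_eq_mul]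
        ring

/-- **The block kernel of a contraction is a contraction**: for a contraction `G` on `ℂ^Λ`, the kernel
`K_{(β,x),(β',y)} = [β = β'] G x y` (`= 1 ⊗ G`) on `ℂ^{ι × Λ}` satisfies `‖K v‖² = Σ_β ‖G v_β‖² ≤ ‖v‖²`.
Horn–Johnson, Matrix Analysis (2012) §5.6. [folklore] -/
theorem re_star_blockKernel_mulVec_le {ι Λ' : Type*} [Fintype ι] [DecidableEq ι] [Fintype Λ']
    (G : Matrix Λ' Λ' ℂ) (hG : ∀ v : Λ' → ℂ, (star (G *ᵥ v) ⬝ᵥ (G *ᵥ v)).re ≤ (star v ⬝ᵥ v).re)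
    (v : ι × Λ' → ℂ) :
    (star ((Matrix.of fun p q : ι × Λ' => if p.1 = q.1 then G p.2 q.2 else 0) *ᵥ v) ⬝ᵥ
        ((Matrix.of fun p q : ι × Λ' => if p.1 = q.1 then G p.2 q.2 else 0) *ᵥ v)).re ≤
      (star v ⬝ᵥ v).re := by
  have hK : ∀ p : ι × Λ',
      ((Matrix.of fun p q : ι × Λ' => if p.1 = q.1 then G p.2 q.2 else 0) *ᵥ v) p =
        (G *ᵥ fun y => v (p.1, y)) p.2 := by
    intro p
    simp only [mulVec, dotProduct, Matrix.of_apply, Fintype.sum_prod_type, ite_mul, zero_mul,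
      Finset.sum_ite_irrel, Finset.sum_const_zero, Finset.sum_ite_eq, Finset.mem_univ, if_true]
  rw [EigenvalueContinuation.re_star_dotProduct_self, EigenvalueContinuation.re_star_dotProduct_self,
    Fintype.sum_prod_type, Fintype.sum_prod_type]
  refine Finset.sum_le_sum fun β _ => ?_
  have h := hG fun y => v (β, y)
  rw [EigenvalueContinuation.re_star_dotProduct_self, EigenvalueContinuation.re_star_dotProduct_self] at h
  simpa only [hK] using h

end Frobenius

/-! ### The creation operator is a contraction -/

section Creation

variable {Λ : Type*} [LinearOrder Λ] [Fintype Λ]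

/-- **`c†_x` is a contraction** (columns restricted to `n`-subsets): `‖c†_x v‖² = Σ_{β ∌ x} |v_β|² ≤ ‖v‖²`,
from the CAR `(c†_x)ᴴ c†_x = c_x c†_x = 1 - n_x`. Bratteli–Robinson II §5.2.2, (5.2.12). [folklore] -/
theorem re_star_creation_submatrix_mulVec_le (x : Λ) (n : ℕ) (v : Config Λ n → ℂ) :
    (star (((creation x).submatrix id (Subtype.val : Config Λ n → Finset Λ)) *ᵥ v) ⬝ᵥ
        (((creation x).submatrix id (Subtype.val : Config Λ n → Finset Λ)) *ᵥ v)).re ≤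
      (star v ⬝ᵥ v).re := by
  set U := (creation x).submatrix id (Subtype.val : Config Λ n → Finset Λ) with hU
  -- `Uᴴ U = (1 - n_x)` restricted to `n`-subsets, a diagonal `0/1` matrix
  have hUU : Uᴴ * U = diagonal fun β : Config Λ n => if x ∈ β.1 then (0 : ℂ) else 1 := by
    have h1 : Uᴴ * U = (annihilation x * creation x).submatrix
        (Subtype.val : Config Λ n → Finset Λ) (Subtype.val : Config Λ n → Finset Λ) := by
      rw [hU, conjTranspose_submatrix, creation_conjTranspose,
        ← submatrix_mul _ _ _ id _ Function.bijective_id]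
    have h2 : annihilation x * creation x = diagonal fun s : Finset Λ => if x ∈ s then (0 : ℂ) else 1 := by
      rw [annihilation_mul_creation, if_pos rfl, show creation x * annihilation x = numberAt x from rfl,
        numberAt_eq_diagonal, ← diagonal_one, diagonal_sub]
      congr 1
      funext s
      split_ifs <;> norm_num
    rw [h1, h2, submatrix_diagonal _ _ Subtype.val_injective]
    rfl
  -- `⟨Uv, Uv⟩ = ⟨v, UᴴU v⟩`
  have hadj : star v ⬝ᵥ ((Uᴴ * U) *ᵥ v) = star (U *ᵥ v) ⬝ᵥ (U *ᵥ v) := by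
    rw [← mulVec_mulVec, dotProduct_mulVec, star_mulVec]
  rw [← hadj, hUU, EigenvalueContinuation.re_star_dotProduct_self, dotProduct, Complex.re_sum]
  refine Finset.sum_le_sum fun β _ => ?_
  rw [mulVec_diagonal, Pi.star_apply]
  split_ifs
  · rw [zero_mul, mul_zero, Complex.zero_re]
    positivity
  · rw [one_mul, Complex.star_def, Complex.conj_mul', ← Complex.ofReal_pow, Complex.ofReal_re]

/-- **The creation-side CAP of the spin-flip majorant** (registered sub-goal of line `majorant`). For every
square `B` on the `n`-subsets of a finite linearly ordered site set `Λ`: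
`Σ_{γ,γ'} ‖(Σ_x C_x B C_xᴴ)_{γγ'}‖² ≤ |Λ|² · Σ_{k,k'} ‖B_{kk'}‖²`, `C_x = (creation x).submatrix id val`
(each `c†_x` is a contraction; Jensen over `x`). Horn–Johnson, Matrix Analysis (2012) §5.6;
Bratteli–Robinson II §5.2.2. [folklore] -/
theorem sum_norm_sq_sum_creation_conj_le :
    ∀ {Λ : Type*} [LinearOrder Λ] [Fintype Λ] (n : ℕ) (B : Matrix (Config Λ n) (Config Λ n) ℂ),
      ∑ γ : Finset Λ, ∑ γ' : Finset Λ,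
          ‖(∑ x : Λ, (creation x).submatrix id (Subtype.val : Config Λ n → Finset Λ) * B *
            ((creation x).submatrix id (Subtype.val : Config Λ n → Finset Λ))ᴴ) γ γ'‖ ^ 2 ≤
        (Fintype.card Λ : ℝ) ^ 2 * ∑ k : Config Λ n, ∑ k' : Config Λ n, ‖B k k'‖ ^ 2 := by
  intro Λ _ _ n B
  exact sum_norm_sq_sum_conj_le _ (fun x v => re_star_creation_submatrix_mulVec_le x n v) B

end Creation

end Summit.HubbardSuperconductivity.HubbardSuperconductivity.Theorems.LiebTwinMajorant.SpinFlip

end
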